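import Literature.IUT.LogThetaLattice.TensorPackets
import Mathlib.FieldTheory.Finite.GaloisField
import HarnessLib

/-!
# [IUTchIII] Prop 3.1 (ii): the schema `Prop31ii_directSummand` (unital `→ₐ` into the `n`-packet) is REFUTABLE

Negative knowledge recorded next to `Literature/IUT/LogThetaLattice/TensorPackets.lean` (abc-iut cell,
L6 ruling D10 (c): negative witnesses are welcome as proof-only companions; FACT-LIST rule R5 «refuted is
never a fact», row F-2125). The FINDING is abc-iut-L3-t12's (STATUS 2026-08-25T19:24:37Z, staged witness
`HOME/staging/L3/L3-t12/Witness_Prop31ii_directSummand.lean` with the fibres `ℚ`, `ℂ`; never filed): the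
typed clause

  `Prop31ii_directSummand 𝕜 L α v := ∃ (ι : PacketAt 𝕜 L α v →ₐ[𝕜] PacketN 𝕜 L) (ρ : … →ₗ[𝕜] …), ρ ∘ ι = id`

asks for a UNITAL `𝕜`-algebra homomorphism `log(^{A,α}𝓕_v) → log(^A𝓕_{v_ℚ})`, whereas the printed
"`log(^{A,α}𝓕_v)` forms a direct summand of the ind-topological ring `log(^A𝓕_{v_ℚ})`" ([IUTchIII] Prop. 3.1
(ii), kurims p. 93) gives the (unital) PROJECTION onto a ring factor and a NON-unital inclusion. This
file records, WITHOUT new definitions or instances (proof-only; the concrete fibres are Mathlib's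
`GaloisField 2 n`, uniform in `n`):

* `not_Prop31ii_directSummand_of_isEmpty_algHom` — over one capsule index (`A = Unit`), if some fibre
  `L () v` admits NO `𝕜`-algebra homomorphism to another fibre `L () v'`, the typed clause FAILS at
  `(α, v) = ((), v)` (a unital `ι` would give `L () v → log(^{A,α}𝓕_v) → log(^A𝓕_{v_ℚ}) ≅ ∏_w L () w → L () v'`);
* `isEmpty_algHom_galoisField_four_two` — there is no `𝔽₂`-algebra homomorphism `𝔽₄ → 𝔽₂` (cardinality);
* `not_Prop31ii_directSummand_galoisField` — hence the schema is false for `𝕜 = 𝔽₂`, `A = Unit`,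
  `Vfib = Bool`, fibres `𝔽₄` (at `true`) and `𝔽₂` (at `false`); `not_forall_Prop31ii_directSummand` — its
  universal closure is refutable.

The TRUE content is abc-iut-L6-t4's repaired `Prop31ii_directSummand'` (`∃ C, PacketN ≃ₐ PacketAt × C`),
PROVED for all packets by abc-iut-L6-t5 (`Prop31ii_directSummand'_of_packets`, TensorPacketsProofs.lean).
Mochizuki's Prop. 3.1 (ii) concerns completions of a number field at the places over `v_ℚ`; nothing here
bears on it or on Cor. 3.12 — typing record only; no side taken. [claim: Mochizuki2012, status: disputed]
-/

namespace Literature.IUT.LogThetaLattice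

open PiTensorProduct

universe u v' w

/-- **IUTchIII:Prop3.1(ii)** (kurims p.93) the typed schema FAILS over one capsule index whenever some fibre
admits no `𝕜`-algebra homomorphism to another fibre: a unital `ι : log(^{A,α}𝓕_v) →ₐ log(^A𝓕_{v_ℚ})` composed
with `log(^α𝓕_v) → log(^{A,α}𝓕_v)` (`toPacketAt`), the identification `⨂_{Unit} ∏_w L () w ≅ ∏_w L () w`
(`PiTensorProduct.liftAlgHom` over the one-point index, abc-iut-L3-t12's `evalUnit`) and the projection to
the `v'`-component is a `𝕜`-algebra homomorphism `L () v →ₐ[𝕜] L () v'`. (Finding of abc-iut-L3-t12,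
2026-08-25T19:24:37Z.) [claim: Mochizuki2012, status: disputed] -/
theorem not_Prop31ii_directSummand_of_isEmpty_algHom (𝕜 : Type u) [Field 𝕜] {Vfib : Type v'}
    [Fintype Vfib] [DecidableEq Vfib] (L : Unit → Vfib → Type w) [∀ α v, CommRing (L α v)]
    [∀ α v, Algebra 𝕜 (L α v)] {v v' : Vfib} (h : IsEmpty (L () v →ₐ[𝕜] L () v')) :
    ¬ Prop31ii_directSummand 𝕜 L () v := by
  rintro ⟨ι, -, -⟩
  -- `⨂_{Unit} ∏_w L () w →ₐ ∏_w L () w`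
  let evalUnit : PacketN 𝕜 L →ₐ[𝕜] Packet1 L () :=
    PiTensorProduct.liftAlgHom
      (MultilinearMap.ofSubsingleton 𝕜 (Packet1 L ()) (Packet1 L ()) () LinearMap.id)
      rfl (fun _ _ => rfl)
  exact h.false
    ((Pi.evalAlgHom 𝕜 (fun w : Vfib => L () w) v').comp
      (evalUnit.comp (ι.comp (toPacketAt 𝕜 L () v))))

/-- There is no `𝔽₂`-algebra homomorphism `𝔽₄ → 𝔽₂` (a ring homomorphism out of a field is injective,
and `4 ≰ 2`). [folklore] -/
private theorem isEmpty_algHom_galoisField_four_two :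
    IsEmpty (GaloisField 2 2 →ₐ[ZMod 2] GaloisField 2 1) := by
  refine ⟨fun φ => ?_⟩
  have hinj : Function.Injective φ := φ.toRingHom.injective
  have hle := Nat.card_le_card_of_injective φ hinj
  rw [GaloisField.card 2 2 two_ne_zero, GaloisField.card 2 1 one_ne_zero] at hle
  norm_num at hle

/-- **IUTchIII:Prop3.1(ii)** (kurims p.93) CONCRETE REFUTATION of the schema `Prop31ii_directSummand`:
`𝕜 = 𝔽₂`, one capsule index, two places in the fibre with local rings `𝔽₄` (at `true`) and `𝔽₂` (at
`false`) — FACT-LIST row F-2125 is refuted-as-typed (rule R5). [claim: Mochizuki2012, status: disputed] -/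
theorem not_Prop31ii_directSummand_galoisField :
    ¬ Prop31ii_directSummand (ZMod 2) (fun (_ : Unit) (b : Bool) => GaloisField 2 (cond b 2 1)) () true :=
  not_Prop31ii_directSummand_of_isEmpty_algHom (ZMod 2)
    (fun (_ : Unit) (b : Bool) => GaloisField 2 (cond b 2 1)) (v := true) (v' := false)
    isEmpty_algHom_galoisField_four_two

/-- **IUTchIII:Prop3.1(ii)** (kurims p.93) hence the UNIVERSAL closure of the schema is refutable (it is
not the case that the clause holds for every field `𝕜`, index data and fibre family); consumers must use
the repaired `Prop31ii_directSummand'` (PROVED: `Prop31ii_directSummand'_of_packets`).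
[claim: Mochizuki2012, status: disputed] -/
theorem not_forall_Prop31ii_directSummand :
    ¬ ∀ (𝕜 : Type) (_ : Field 𝕜) (A : Type) (_ : Fintype A) (_ : DecidableEq A) (Vfib : Type)
        (_ : Fintype Vfib) (_ : DecidableEq Vfib) (L : A → Vfib → Type) (_ : ∀ α v, CommRing (L α v))
        (_ : ∀ α v, Algebra 𝕜 (L α v)) (α : A) (v : Vfib), Prop31ii_directSummand 𝕜 L α v :=
  fun h => not_Prop31ii_directSummand_galoisField
    (h (ZMod 2) inferInstance Unit inferInstance inferInstance Bool inferInstance inferInstance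
      (fun _ b => GaloisField 2 (cond b 2 1)) (fun _ _ => inferInstance) (fun _ _ => inferInstance) () true)

end Literature.IUT.LogThetaLattice
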